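import Summits.Schanuel.Schanuel.Theorems.ZilberEacBranchPoleFibreGrowth
import Summits.Schanuel.Schanuel.Theorems.ZilberEacRowsBezout
import Summits.Schanuel.Schanuel.Theorems.ZilberEacBranchKernel
import HarnessLib

/-!
# Arbitrary base branches, LIV: polynomial fibres over an ARBITRARY monic plane curve along a
# place at infinity with a good direction — case ∧ dense

HONEST FRAMING.  Cell `pub-schanuel` (Zilber's Exponential-Algebraic Closedness, case ladder;
host summit Schanuel), seat 2, gen 30.  The method of files LI–LIII needs from the base curve only:
(i) `C : F(x₀, x₁) = 0` with `F ∈ ℂ[x₀][x₁]` MONIC and IRREDUCIBLE; (ii) a PLACE AT INFINITY in the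
cell's chart, `x₀ = s^{-k}`, `x₁ = Φ(s)s^{-M}` (`k, M ≥ 1`, `Φ` analytic, `Φ(0) ≠ 0`); (iii) a good
direction `Re(Φ(0)z^M) ≠ 0` for some `z^k = 2πi` (file XXXII).  Then for EVERY `R ∈ ℂ[x₀, x₁]`
nonzero somewhere on `C` the value of `R` along the place is `ψ(s)s^L`, `ψ(0) ≠ 0`
(**`exists_place_normalForm`**: the rows `G = R mod F` have `x₁`-degree `< deg F`, so by the Bézout
lemma of file LIII (a) they cannot vanish along the place; isolated zeros), and
**`unprojectedDense_monicCurve_polyFibre`**: `{F(x₀, x₁) = 0, y₀ = R(x₀, x₁)}` has Zariski-dense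
exponential points.  The case certificate **`mmCase_monicCurve_polyFibre`** (`deg_{x₁} F ≥ 2`) uses
Bézout once more: an irreducible curve of degree `≥ 2` in `x₁` lies on no line.  This is the
polynomial-fibre part of O84 (a1) ("presentation of `W` over `ℂ(C)`") for every base curve with such
a place; the existence of the place (Newton–Puiseux) and the direction condition remain hypotheses.
Decided instances of an OPEN question (Mantova–Masser, PLMS 2024 §1 p. 5); EC(3,2) OPEN; NOT
Schanuel's conjecture (neither used nor implied); EAC ⇏ SC.
-/

noncomputable section

open Filter Topology Set Complex Polynomial
open Literature.NumberTheory.Transcendental Literature.ModelTheory.Zilber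
open Literature.ModelTheory.ExponentialFields

set_option linter.dupNamespace false

namespace Summit.Schanuel.Schanuel.Theorems

section MonicCurve

variable (F : ℂ[X][X])

/-! ## Part A. Rows modulo `F` and their non-vanishing along a place -/

/-- **A polynomial of `x₁`-degree `< deg F` vanishing along a place of `F = 0` with `x₀ → ∞` is
zero** (`F` monic irreducible; the place: `x₀ = s^{-k}`, `x₁ = x₁(s)` for small `s ≠ 0`, `k ≥ 1`).
[folklore] -/
theorem rows_eq_zero_of_eventually_zero_along_place (hFm : F.Monic) (hFirr : Irreducible F)
    (G : ℂ[X][X]) (hdeg : G.natDegree < F.natDegree) {k : ℕ} (hk : 1 ≤ k) {x₁ : ℂ → ℂ}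
    (hplace : ∀ᶠ s in 𝓝[≠] (0 : ℂ), (F.map (Polynomial.evalRingHom (s ^ k)⁻¹)).eval (x₁ s) = 0)
    (hG : ∀ᶠ s in 𝓝[≠] (0 : ℂ), (G.map (Polynomial.evalRingHom (s ^ k)⁻¹)).eval (x₁ s) = 0) :
    G = 0 := by
  by_contra hG0
  obtain ⟨U, V, D, hD, hUV⟩ := exists_bezout_of_irreducible F G hFm hFirr hG0 hdeg
  have hx₀ : Tendsto (fun s : ℂ => ‖(s ^ k)⁻¹‖) (𝓝[≠] (0 : ℂ)) atTop := by
    have h1 : Tendsto (fun s : ℂ => s ^ k) (𝓝[≠] (0 : ℂ)) (𝓝[≠] 0) := by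
      refine tendsto_nhdsWithin_iff.2 ⟨?_, ?_⟩
      · have : Tendsto (fun s : ℂ => s ^ k) (𝓝 (0 : ℂ)) (𝓝 (0 ^ k)) :=
          (continuous_pow k).continuousAt.tendsto
        rw [zero_pow (by omega)] at this
        exact this.mono_left nhdsWithin_le_nhds
      · filter_upwards [self_mem_nhdsWithin] with s hs
        exact pow_ne_zero _ hs
    exact (tendsto_norm_inv_nhdsNE_zero_atTop (α := ℂ)).comp h1
  exact not_eventually_rows_eq_zero_of_bezout hD hUV hx₀ hplace hG

/-- **Reduction to rows of `x₁`-degree `< deg F`** (`F` monic of positive degree): for every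
`R ∈ ℂ[x₀, x₁]` there is `G` with `deg_{x₁} G < deg_{x₁} F` and `R(x, y) = G(x, y)` whenever
`F(x, y) = 0`. [folklore] -/
theorem exists_rows_reduction_monic (hFm : F.Monic) (hn : 1 ≤ F.natDegree)
    (R : MvPolynomial (Fin 2) ℂ) :
    ∃ G : ℂ[X][X], G.natDegree < F.natDegree ∧ ∀ x y : ℂ,
      (F.map (Polynomial.evalRingHom x)).eval y = 0 →
      MvPolynomial.eval ![x, y] R = (G.map (Polynomial.evalRingHom x)).eval y := by
  classical
  obtain ⟨Φr, hΦr⟩ := exists_rowsEquiv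
  have hF1 : F ≠ 1 := by
    intro h
    rw [h, Polynomial.natDegree_one] at hn
    omega
  refine ⟨Φr R %ₘ F, Polynomial.natDegree_modByMonic_lt (Φr R) hFm hF1, fun x y hy => ?_⟩
  rw [hΦr]
  conv_lhs => rw [← Polynomial.modByMonic_add_div (Φr R) F]
  rw [Polynomial.map_add, Polynomial.map_mul, Polynomial.eval_add, Polynomial.eval_mul, hy, zero_mul,
    add_zero]

/-! ## Part B. The normal form of the fibre value along a place -/

/-- **Normal form along a place.**  `F` monic irreducible, `G ≠ 0` with `deg_{x₁} G < deg F`, the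
place `x₀ = s^{-k}`, `x₁ = Φ(s)s^{-M}` (`k ≥ 1`, `Φ` analytic): `G(x₀, x₁) = ψ(s)s^{L}` for small
`s ≠ 0`, `ψ` analytic, `ψ(0) ≠ 0`, `L ∈ ℤ`. [folklore] -/
theorem exists_place_normalForm (hFm : F.Monic) (hFirr : Irreducible F) (G : ℂ[X][X]) (hG : G ≠ 0)
    (hdeg : G.natDegree < F.natDegree) {k : ℕ} (hk : 1 ≤ k) (M : ℕ) {Φ : ℂ → ℂ}
    (hΦan : AnalyticAt ℂ Φ 0)
    (hplace : ∀ᶠ s in 𝓝[≠] (0 : ℂ),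
      (F.map (Polynomial.evalRingHom (s ^ k)⁻¹)).eval (Φ s * (s ^ M)⁻¹) = 0) :
    ∃ (ψ : ℂ → ℂ) (L : ℤ), AnalyticAt ℂ ψ 0 ∧ ψ 0 ≠ 0 ∧
      ∀ᶠ s in 𝓝[≠] (0 : ℂ),
        (G.map (Polynomial.evalRingHom (s ^ k)⁻¹)).eval (Φ s * (s ^ M)⁻¹) = ψ s * s ^ L := by
  classical
  set n : ℕ := G.natDegree with hn
  have hrow : ∀ j : ℕ, ∃ U : ℂ → ℂ, AnalyticAt ℂ U 0 ∧
      ∀ s : ℂ, s ≠ 0 → (G.coeff j).eval (s ^ k)⁻¹ = U s * (s ^ (k * (G.coeff j).natDegree))⁻¹ := by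
    intro j
    obtain ⟨U, hUan, -, hUev⟩ :=
      exists_polarForm_eval (G.coeff j) (U := fun _ : ℂ => (1 : ℂ)) analyticAt_const hk
    refine ⟨U, hUan, fun s hs => ?_⟩
    have h := hUev s hs
    rw [one_mul, inv_pow, inv_pow] at h
    exact h
  choose U hUan hUev using hrow
  set N₁ : ℕ → ℕ := fun j => k * (G.coeff j).natDegree + j * M with hN₁
  set N : ℕ := ∑ j ∈ Finset.range (n + 1), N₁ j with hNdef
  have hN₁le : ∀ j ∈ Finset.range (n + 1), N₁ j ≤ N := fun j hj =>
    Finset.single_le_sum (fun i _ => Nat.zero_le (N₁ i)) hj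
  set g : ℂ → ℂ := fun s => ∑ j ∈ Finset.range (n + 1), U j s * Φ s ^ j * s ^ (N - N₁ j) with hg
  have hid : AnalyticAt ℂ (fun s : ℂ => s) 0 := analyticAt_id
  have hgan : AnalyticAt ℂ g 0 := by
    rw [hg]
    refine Finset.analyticAt_fun_sum _ fun j _ => ?_
    exact ((hUan j).mul (hΦan.pow j)).mul (hid.pow _)
  have hfexp : ∀ s : ℂ, (G.map (Polynomial.evalRingHom (s ^ k)⁻¹)).eval (Φ s * (s ^ M)⁻¹) =
      ∑ j ∈ Finset.range (n + 1), (G.coeff j).eval (s ^ k)⁻¹ * (Φ s * (s ^ M)⁻¹) ^ j := by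
    intro s
    rw [Polynomial.eval_map, Polynomial.eval₂_eq_sum_range]
    rfl
  have hgf : ∀ s : ℂ, s ≠ 0 → (G.map (Polynomial.evalRingHom (s ^ k)⁻¹)).eval (Φ s * (s ^ M)⁻¹) =
      g s * s ^ (-(N : ℤ)) := by
    intro s hs
    rw [hfexp, hg, Finset.sum_mul]
    refine Finset.sum_congr rfl fun j hj => ?_
    rw [hUev j s hs, zpow_neg, zpow_natCast, pow_sub₀ s hs (hN₁le j hj)]
    simp only [hN₁, pow_add, pow_mul, mul_pow, inv_pow]
    field_simp
    ring
  have hg_ne : ¬ ∀ᶠ s in 𝓝 (0 : ℂ), g s = 0 := by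
    intro hg0
    apply hG
    refine rows_eq_zero_of_eventually_zero_along_place F hFm hFirr G hdeg hk hplace ?_
    filter_upwards [eventually_nhdsWithin_of_eventually_nhds hg0, self_mem_nhdsWithin] with s hgs hs0
    rw [hgf s hs0, hgs, zero_mul]
  obtain ⟨m, ψ, hψan, hψ0, hgψ⟩ := hgan.exists_eventuallyEq_pow_smul_nonzero_iff.2 hg_ne
  refine ⟨ψ, (m : ℤ) - (N : ℤ), hψan, hψ0, ?_⟩
  filter_upwards [eventually_nhdsWithin_of_eventually_nhds hgψ, self_mem_nhdsWithin] with s h2 hs0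
  have hs0' : s ≠ 0 := hs0
  rw [hgf s hs0', h2, sub_zero, smul_eq_mul, zpow_sub₀ hs0', zpow_natCast, zpow_neg, zpow_natCast,
    div_eq_mul_inv]
  ring

/-! ## Part C. Density along a good place -/

/-- **Polynomial fibres over a monic irreducible plane curve along a good place: dense.**  `F`
monic irreducible of positive `x₁`-degree; a place at infinity `x₀ = s^{-k}`, `x₁ = Φ(s)s^{-M}`
(`k, M ≥ 1`, `Φ` analytic) with a good direction `Re(Φ(0)z^M) ≠ 0`, `z^k = 2πi`; `R ∈ ℂ[x₀, x₁]`
nonzero somewhere on the curve: `{F(x₀, x₁) = 0, y₀ = R(x₀, x₁)}` has Zariski-dense exponential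
points. [cite: MantovaMasser2023, §1 Further remarks, p. 5 (the question, open in general)] (new) -/
theorem unprojectedDense_monicCurve_polyFibre (hFm : F.Monic) (hFirr : Irreducible F)
    (hn : 1 ≤ F.natDegree) {k M : ℕ} (hk : 1 ≤ k) (hM : 1 ≤ M) {Φ : ℂ → ℂ} (hΦan : AnalyticAt ℂ Φ 0)
    (hplace : ∀ᶠ s in 𝓝[≠] (0 : ℂ),
      (F.map (Polynomial.evalRingHom (s ^ k)⁻¹)).eval (Φ s * (s ^ M)⁻¹) = 0)
    (hdir : ∃ z : ℂ, z ^ k = 2 * Real.pi * I ∧ (Φ 0 * z ^ M).re ≠ 0)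
    (R : MvPolynomial (Fin 2) ℂ)
    (hR : ∃ x y : ℂ, (F.map (Polynomial.evalRingHom x)).eval y = 0 ∧ MvPolynomial.eval ![x, y] R ≠ 0) :
    UnprojectedDense {w : Fin 2 ⊕ Fin 2 → ℂ |
      (F.map (Polynomial.evalRingHom (w (Sum.inl 0)))).eval (w (Sum.inl 1)) = 0 ∧
      w (Sum.inr 0) = MvPolynomial.eval ![w (Sum.inl 0), w (Sum.inl 1)] R} := by
  classical
  obtain ⟨Φr, hΦr⟩ := exists_rowsEquiv
  -- the curve as a two-variable polynomial
  set A : MvPolynomial (Fin 2) ℂ := Φr.symm F with hA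
  have hPQ : ∀ x y : ℂ, MvPolynomial.eval ![x, y] A = (F.map (Polynomial.evalRingHom x)).eval y := by
    intro x y
    rw [hΦr, hA, RingEquiv.apply_symm_apply]
  have hirrA : Irreducible A := (irreducible_rows_iff hPQ).2 hFirr
  have hset : {w : Fin 2 ⊕ Fin 2 → ℂ |
      (F.map (Polynomial.evalRingHom (w (Sum.inl 0)))).eval (w (Sum.inl 1)) = 0 ∧
      w (Sum.inr 0) = MvPolynomial.eval ![w (Sum.inl 0), w (Sum.inl 1)] R} =
      {w : Fin 2 ⊕ Fin 2 → ℂ | MvPolynomial.eval ![w (Sum.inl 0), w (Sum.inl 1)] A = 0 ∧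
        w (Sum.inr 0) = MvPolynomial.eval ![w (Sum.inl 0), w (Sum.inl 1)] R} := by
    ext w
    simp only [Set.mem_setOf_eq, hPQ]
  rw [hset]
  have hS := isIrreducibleClosed_curveGraphFibre R hirrA
  have hdim := zariskiDim_curveGraphFibre R hirrA
  obtain ⟨G, hGdeg, hGev⟩ := exists_rows_reduction_monic F hFm hn R
  have hG0 : G ≠ 0 := by
    intro hG
    obtain ⟨x, y, hxy, hxR⟩ := hR
    apply hxR
    rw [hGev x y hxy, hG, Polynomial.map_zero, Polynomial.eval_zero]
  obtain ⟨ψ, L, hψan, hψ0, hf⟩ := exists_place_normalForm F hFm hFirr G hG0 hGdeg hk M hΦan hplace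
  refine unprojectedDense_branch_poleFibre_of_exists_direction hS (le_of_eq hdim) hk hM L hψan hψ0
    hΦan hdir ?_
  filter_upwards [hplace, hf] with s hs hfs
  refine ⟨?_, ?_⟩
  · simp only [Sum.elim_inl, Matrix.cons_val_zero, Matrix.cons_val_one]
    rw [hPQ]
    exact hs
  · simp only [Sum.elim_inr, Sum.elim_inl, Matrix.cons_val_zero, Matrix.cons_val_one]
    rw [hGev _ _ hs, hfs]

/-! ## Part D. Mantova–Masser's case -/

/-- Every fibre of `x₀` meets a curve that is monic of positive degree in `x₁`. [folklore] -/
theorem monicCurve_exists_root (hFm : F.Monic) (hn : 1 ≤ F.natDegree) (x : ℂ) :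
    ∃ y : ℂ, (F.map (Polynomial.evalRingHom x)).eval y = 0 := by
  have hmon : (F.map (Polynomial.evalRingHom x)).Monic := hFm.map _
  have hnd : (F.map (Polynomial.evalRingHom x)).natDegree = F.natDegree := hFm.natDegree_map _
  have hdeg : (F.map (Polynomial.evalRingHom x)).degree ≠ 0 := by
    rw [Polynomial.degree_eq_natDegree hmon.ne_zero, hnd]
    exact_mod_cast (by omega : F.natDegree ≠ 0)
  obtain ⟨y, hy⟩ := IsAlgClosed.exists_root _ hdeg
  exact ⟨y, hy⟩

/-- **An irreducible curve of `x₁`-degree `≥ 2`, monic in `x₁`, lies on no line** (Bézout with the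
rows of the line). [folklore] -/
theorem monicCurve_exists_offLine (hFm : F.Monic) (hFirr : Irreducible F) (hn : 2 ≤ F.natDegree)
    (m : Fin 2 → ℤ) (hm : m ≠ 0) (c₀ : ℂ) :
    ∃ x y : ℂ, (F.map (Polynomial.evalRingHom x)).eval y = 0 ∧
      (m 0 : ℂ) * x + (m 1 : ℂ) * y ≠ c₀ := by
  classical
  by_contra hall
  push Not at hall
  by_cases hm1 : (m 1 : ℂ) = 0
  · have hm0 : (m 0 : ℂ) ≠ 0 := by
      intro h0
      apply hm
      funext i
      fin_cases i
      · exact_mod_cast h0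
      · exact_mod_cast hm1
    obtain ⟨y₀, hy₀⟩ := monicCurve_exists_root F hFm (by omega) 0
    obtain ⟨y₁, hy₁⟩ := monicCurve_exists_root F hFm (by omega) 1
    have h0 := hall 0 y₀ hy₀
    have h1 := hall 1 y₁ hy₁
    rw [hm1] at h0 h1
    apply hm0
    linear_combination h1 - h0
  · set Rl : ℂ[X][X] := C (C (m 1 : ℂ)) * X + C (C (m 0 : ℂ) * X - C c₀) with hRl
    have hRl1 : Rl.natDegree ≤ 1 := Polynomial.natDegree_linear_le
    have hRl0 : Rl ≠ 0 := by
      intro h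
      have h1 := congrArg (fun p : ℂ[X][X] => (p.coeff 1).coeff 0) h
      simp only [hRl, Polynomial.coeff_add, Polynomial.coeff_C_mul, Polynomial.coeff_X_one, mul_one,
        Polynomial.coeff_C_succ, add_zero, Polynomial.coeff_C_zero, Polynomial.coeff_zero] at h1
      exact hm1 h1
    obtain ⟨U, V, D, hD, hUV⟩ := exists_bezout_of_irreducible F Rl hFm hFirr hRl0 (by omega)
    apply hD
    refine Polynomial.funext fun x => ?_
    obtain ⟨y, hy⟩ := monicCurve_exists_root F hFm (by omega) x
    have hline := hall x y hy
    have hRl_eval : (Rl.map (Polynomial.evalRingHom x)).eval y = 0 := by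
      simp only [hRl, Polynomial.map_add, Polynomial.map_mul, Polynomial.map_C,
        Polynomial.map_X, Polynomial.eval_add, Polynomial.eval_mul, Polynomial.eval_sub,
        Polynomial.eval_C, Polynomial.eval_X, Polynomial.coe_evalRingHom]
      linear_combination hline
    have h := congrArg (fun G : ℂ[X][X] => (G.map (Polynomial.evalRingHom x)).eval y) hUV
    simp only [Polynomial.map_add, Polynomial.map_mul, Polynomial.eval_add, Polynomial.eval_mul, hy,
      hRl_eval, mul_zero, add_zero, Polynomial.map_C, Polynomial.eval_C,
      Polynomial.coe_evalRingHom] at h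
    rw [Polynomial.eval_zero]
    exact h.symm

/-- **The cylinder `{F(x₀, x₁) = 0, y₀ = R(x₀, x₁)}` is in Mantova–Masser's case** (`F` monic
irreducible of `x₁`-degree `≥ 2`; `R` nonzero somewhere on the curve). (new) -/
theorem mmCase_monicCurve_polyFibre (hFm : F.Monic) (hFirr : Irreducible F) (hn : 2 ≤ F.natDegree)
    (R : MvPolynomial (Fin 2) ℂ)
    (hR : ∃ x y : ℂ, (F.map (Polynomial.evalRingHom x)).eval y = 0 ∧ MvPolynomial.eval ![x, y] R ≠ 0) :
    MMCaseDimPiOneFree {w : Fin 2 ⊕ Fin 2 → ℂ |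
      (F.map (Polynomial.evalRingHom (w (Sum.inl 0)))).eval (w (Sum.inl 1)) = 0 ∧
      w (Sum.inr 0) = MvPolynomial.eval ![w (Sum.inl 0), w (Sum.inl 1)] R} := by
  classical
  obtain ⟨Φr, hΦr⟩ := exists_rowsEquiv
  set A : MvPolynomial (Fin 2) ℂ := Φr.symm F with hA
  have hPQ : ∀ x y : ℂ, MvPolynomial.eval ![x, y] A = (F.map (Polynomial.evalRingHom x)).eval y := by
    intro x y
    rw [hΦr, hA, RingEquiv.apply_symm_apply]
  have hirrA : Irreducible A := (irreducible_rows_iff hPQ).2 hFirr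
  have hset : {w : Fin 2 ⊕ Fin 2 → ℂ |
      (F.map (Polynomial.evalRingHom (w (Sum.inl 0)))).eval (w (Sum.inl 1)) = 0 ∧
      w (Sum.inr 0) = MvPolynomial.eval ![w (Sum.inl 0), w (Sum.inl 1)] R} =
      {w : Fin 2 ⊕ Fin 2 → ℂ | MvPolynomial.eval ![w (Sum.inl 0), w (Sum.inl 1)] A = 0 ∧
        w (Sum.inr 0) = MvPolynomial.eval ![w (Sum.inl 0), w (Sum.inl 1)] R} := by
    ext w
    simp only [Set.mem_setOf_eq, hPQ]
  rw [hset]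
  refine mmCase_curveGraphFibre hirrA ?_ ?_
  · obtain ⟨x, y, hxy, hne⟩ := hR
    exact ⟨![x, y], by rw [hPQ]; exact hxy, hne⟩
  · intro m hm c₀
    obtain ⟨x, y, hxy, hne⟩ := monicCurve_exists_offLine F hFm hFirr hn m hm c₀
    exact ⟨![x, y], by rw [hPQ]; exact hxy, by simpa using hne⟩

/-- **Mantova–Masser's question for polynomial fibres over a monic irreducible plane curve along a
good place: case ∧ dense** (`deg_{x₁} F ≥ 2`; place and direction as above; `R` nonzero somewhere
on the curve). [cite: MantovaMasser2023, §1 Further remarks, p. 5 (the question, open in general)]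
(new) -/
theorem unprojectedDensityQuestion_monicCurve_polyFibre (hFm : F.Monic) (hFirr : Irreducible F)
    (hn : 2 ≤ F.natDegree) {k M : ℕ} (hk : 1 ≤ k) (hM : 1 ≤ M) {Φ : ℂ → ℂ}
    (hΦan : AnalyticAt ℂ Φ 0)
    (hplace : ∀ᶠ s in 𝓝[≠] (0 : ℂ),
      (F.map (Polynomial.evalRingHom (s ^ k)⁻¹)).eval (Φ s * (s ^ M)⁻¹) = 0)
    (hdir : ∃ z : ℂ, z ^ k = 2 * Real.pi * I ∧ (Φ 0 * z ^ M).re ≠ 0)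
    (R : MvPolynomial (Fin 2) ℂ)
    (hR : ∃ x y : ℂ, (F.map (Polynomial.evalRingHom x)).eval y = 0 ∧ MvPolynomial.eval ![x, y] R ≠ 0) :
    MMCaseDimPiOneFree {w : Fin 2 ⊕ Fin 2 → ℂ |
        (F.map (Polynomial.evalRingHom (w (Sum.inl 0)))).eval (w (Sum.inl 1)) = 0 ∧
        w (Sum.inr 0) = MvPolynomial.eval ![w (Sum.inl 0), w (Sum.inl 1)] R} ∧
      UnprojectedDense {w : Fin 2 ⊕ Fin 2 → ℂ |
        (F.map (Polynomial.evalRingHom (w (Sum.inl 0)))).eval (w (Sum.inl 1)) = 0 ∧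
        w (Sum.inr 0) = MvPolynomial.eval ![w (Sum.inl 0), w (Sum.inl 1)] R} :=
  ⟨mmCase_monicCurve_polyFibre F hFm hFirr hn R hR,
    unprojectedDense_monicCurve_polyFibre F hFm hFirr (by omega) hk hM hΦan hplace hdir R hR⟩

/-- **No direction hypothesis when `k ∤ 2M`** (file XX's `exists_direction_of_not_dvd`): polynomial
fibres over a monic irreducible plane curve of `x₁`-degree `≥ 2` along a place `x₀ = s^{-k}`,
`x₁ = Φ(s)s^{-M}` with `Φ(0) ≠ 0` and `k ∤ 2M`: case ∧ dense. [cite: MantovaMasser2023, §1 Further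
remarks, p. 5 (the question, open in general)] (new) -/
theorem unprojectedDensityQuestion_monicCurve_polyFibre_of_not_dvd (hFm : F.Monic)
    (hFirr : Irreducible F) (hn : 2 ≤ F.natDegree) {k M : ℕ} (hk : 1 ≤ k) (hM : 1 ≤ M)
    (hkM : ¬ k ∣ 2 * M) {Φ : ℂ → ℂ} (hΦan : AnalyticAt ℂ Φ 0) (hΦ0 : Φ 0 ≠ 0)
    (hplace : ∀ᶠ s in 𝓝[≠] (0 : ℂ),
      (F.map (Polynomial.evalRingHom (s ^ k)⁻¹)).eval (Φ s * (s ^ M)⁻¹) = 0)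
    (R : MvPolynomial (Fin 2) ℂ)
    (hR : ∃ x y : ℂ, (F.map (Polynomial.evalRingHom x)).eval y = 0 ∧ MvPolynomial.eval ![x, y] R ≠ 0) :
    MMCaseDimPiOneFree {w : Fin 2 ⊕ Fin 2 → ℂ |
        (F.map (Polynomial.evalRingHom (w (Sum.inl 0)))).eval (w (Sum.inl 1)) = 0 ∧
        w (Sum.inr 0) = MvPolynomial.eval ![w (Sum.inl 0), w (Sum.inl 1)] R} ∧
      UnprojectedDense {w : Fin 2 ⊕ Fin 2 → ℂ |
        (F.map (Polynomial.evalRingHom (w (Sum.inl 0)))).eval (w (Sum.inl 1)) = 0 ∧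
        w (Sum.inr 0) = MvPolynomial.eval ![w (Sum.inl 0), w (Sum.inl 1)] R} :=
  unprojectedDensityQuestion_monicCurve_polyFibre F hFm hFirr hn hk hM hΦan hplace
    (exists_direction_of_not_dvd hk hkM hΦ0) R hR

end MonicCurve

end Summit.Schanuel.Schanuel.Theorems

end
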